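import Mathlib
import Summits.Ventures.HodgeRepro.Tier4.Common.AdelicDefs
import Summits.Ventures.HodgeRepro.Tier4.Common.AdelicRTF
import Summits.Ventures.HodgeRepro.Tier4.Common.MixedPlaneCusp
import Summits.Ventures.HodgeRepro.Tier4.Line1.PlaneDefs
import Summits.Ventures.HodgeRepro.Tier4.Line1.RationalPoints
import Summits.Ventures.HodgeRepro.Tier4.Line4.ThetaEquivariance
import Summits.Ventures.HodgeRepro.Tier4.Line4.GeometricSide
import Summits.Ventures.HodgeRepro.Tier4.Line4.OrbitalUnfold

/-!
# Tier4/Line4/OrbitalUnfoldCentralCosets — C-L4-UNFOLD-Z, part 1: the rational centre `Z(k)` inside `T(𝔸)`, the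
cosets `T(k)/Z(k)`, and the parametrisation of a regular rational orbit by `(T(k)/Z(k)) × T′(k)`

Blind re-derivation cell `pub-hodge-repro`, Tier 4 «PROVE THE STEP» (README §9–§10), LINE L4, cut C-L4-UNFOLD-Z
(t4-plan-4 g3 S14244: statement typed by the planner, taken S14245); seat t4-L2-p3 (gen 3).  Part 1 of 2 (the ≤ 400-line
rule); part 2 = `Line4/OrbitalUnfoldCentral` (the cut itself).  Builds on t4-L4-p2's `Line4/OrbitalUnfold` (`orbitMap`,
`orbitMap_val`) and t4-L4-p1's `countable_rationalOf`; nothing of theirs is restated.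

* `isFundamentalDomain_iUnion_smul_of_bijective`: a generic measure-theoretic tool — if `s` is a fundamental domain for
  `G` and `(z, i) ↦ ι z · r i` is a bijection `K × I → G` (`ι : K →* G` compatible with the actions), then
  `⋃ i, r i • s` is a fundamental domain for `K`;
* `rationalCentreT W = T(k) ∩ Z` as a subgroup of `T(𝔸)` (the planner's definition); its elements are rational, central
  (`rationalCentreT.comm`), and it is countable; `centreIncl : Z(k) →* T(k)`, `centreInT' : Z(k) → T′(k)` (the same adelic
  element); `cosetQuot = T(k)/Z(k)` (Mathlib's left-coset quotient; `Z(k)` central, so left = right), `cosetRep`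
  (`Quotient.out`), and `bijective_centreIncl_mul_cosetRep`: `(z, c) ↦ z · σ(c)` is a bijection `Z(k) × (T(k)/Z(k)) → T(k)`;
* `stabiliser_of_orbitMap_eq` (`IsRegularRational`: two pairs with the same orbit point differ by a diagonal central
  element), `orbitMap_mul_centre`, `orbitMapRep` (`(c, δ′) ↦ σ(c)⁻¹ γ₀ δ′`), `orbitMapRep_injective`, `range_orbitMapRep`,
  and **(a)** `tsum_orbit_eq_tsum_tsum_rep`: the orbit sum is the double sum over `(T(k)/Z(k)) × T′(k)`.

KERNEL NOTE: every identification of an element of `T′` with one of `T` goes through an explicit lemma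
(`centreInT'_val`, `centreInT'_coe`) and `rw`, never `rfl`/`exact` — a kernel defeq check that compares memberships in
`torusT W` and `torusT' W` unfolds the matrix equations of the commutants and times out.

Nothing here asserts any hypothesis; nothing is about the wall's truth.  HC_CM is NOT proved by anyone in this
repository.
-/

set_option autoImplicit false

noncomputable section

namespace Summit.Ventures.HodgeRepro.Tier4.Line4

open Summit.Ventures.HodgeRepro.Tier4.Common Summit.Ventures.HodgeRepro.Tier4.Line1 MeasureTheory NumberField
open scoped Pointwise

/-! ### 1. A generic tool: a fundamental domain for a subgroup from one of the group and coset representatives -/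

section Generic

variable {G K α I : Type*} [Group G] [Group K] [MulAction G α] [MulAction K α] [MeasurableSpace α]
  {μ : Measure α} [Countable G] [MeasurableConstSMul G α] [SMulInvariantMeasure G α μ]

/-- **Fundamental domain of a subgroup from coset representatives.** If `s` is a fundamental domain for `G`, `ι : K →* G`
is compatible with the actions and `(z, i) ↦ ι z · r i` is a bijection `K × I → G`, then `⋃ i, r i • s` is a
fundamental domain for `K`. -/
theorem isFundamentalDomain_iUnion_smul_of_bijective {s : Set α} (hs : IsFundamentalDomain G s μ) (ι : K →* G)
    (hι : ∀ (z : K) (x : α), z • x = ι z • x) (r : I → G)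
    (hbij : Function.Bijective (fun p : K × I => ι p.1 * r p.2)) :
    IsFundamentalDomain K (⋃ i, r i • s) μ := by
  haveI : Countable I := by
    refine Function.Injective.countable (f := fun i : I => ι 1 * r i) fun i j hij => ?_
    have := hbij.1 (a₁ := (1, i)) (a₂ := (1, j)) hij
    exact (Prod.mk.inj this).2
  have hιset : ∀ (z : K) (t : Set α), z • t = ι z • t := by
    intro z t
    ext x
    simp only [Set.mem_smul_set, hι]
  refine ⟨NullMeasurableSet.iUnion fun i => hs.nullMeasurableSet_smul (r i), ?_, ?_⟩
  · refine hs.ae_covers.mono fun x hx => ?_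
    obtain ⟨g, hg⟩ := hx
    obtain ⟨⟨z, i⟩, hzi⟩ := hbij.2 g⁻¹
    refine ⟨z⁻¹, Set.mem_iUnion.2 ⟨i, ?_⟩⟩
    rw [Set.mem_smul_set_iff_inv_smul_mem, hι, map_inv, smul_smul]
    have h1 : (r i)⁻¹ * (ι z)⁻¹ = g := by
      rw [← mul_inv_rev]
      simp only at hzi
      rw [hzi, inv_inv]
    rw [h1]
    exact hg
  · intro z₁ z₂ hne
    simp only [Function.onFun, Set.smul_set_iUnion]
    refine AEDisjoint.iUnion_left_iff.2 fun i => AEDisjoint.iUnion_right_iff.2 fun j => ?_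
    rw [hιset, hιset, smul_smul, smul_smul]
    refine hs.aedisjoint fun h => hne ?_
    have := hbij.1 (a₁ := (z₁, i)) (a₂ := (z₂, j)) h
    exact (Prod.mk.inj this).1

end Generic

/-! ### 2. The rational centre inside `T(𝔸)` and the coset representatives -/

section Centre

variable {k : Type} [Field k] [NumberField k] (W : PlaneData k)

/-- **The rational centre inside `T(𝔸)`**: `Z(k) = T(k) ∩ Z` as a subgroup of `T(𝔸)` (planner's definition, S14244). -/
def rationalCentreT : Subgroup (torusT W) := rationalOf W (torusT W) ⊓ (centre W).subgroupOf (torusT W)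

/-- `Z(k) ≤ T(k)` inside `T(𝔸)`. -/
theorem rationalCentreT_le : rationalCentreT W ≤ rationalOf W (torusT W) := inf_le_left

/-- An element of `Z(k)` is rational. -/
theorem rationalCentreT.mem_rationalPoints {z : torusT W} (hz : z ∈ rationalCentreT W) :
    (z : GA W) ∈ rationalPoints W :=
  Subgroup.mem_subgroupOf.1 (Subgroup.mem_inf.1 hz).1

/-- An element of `Z(k)` lies in the centre `Z`. -/
theorem rationalCentreT.mem_centre {z : torusT W} (hz : z ∈ rationalCentreT W) : (z : GA W) ∈ centre W :=
  Subgroup.mem_subgroupOf.1 (Subgroup.mem_inf.1 hz).2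

/-- An element of `Z(k)` commutes with every element of `G(𝔸)`. -/
theorem rationalCentreT.comm {z : torusT W} (hz : z ∈ rationalCentreT W) (g : GA W) :
    g * (z : GA W) = (z : GA W) * g :=
  Subgroup.mem_center_iff.1 (centre_le_center W (rationalCentreT.mem_centre W hz)) g

/-- An element of `Z(k)` commutes with every element of `T(𝔸)`. -/
theorem rationalCentreT.comm_torus {z : torusT W} (hz : z ∈ rationalCentreT W) (t : torusT W) :
    t * z = z * t :=
  Subtype.ext (rationalCentreT.comm W hz (t : GA W))

/-- The inclusion `Z(k) → T(k)`. -/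
def centreIncl : rationalCentreT W →* rationalOf W (torusT W) := Subgroup.inclusion (rationalCentreT_le W)

/-- `Z(k)` as a subgroup of `T(k)`. -/
def centreInT : Subgroup (rationalOf W (torusT W)) := (rationalCentreT W).subgroupOf (rationalOf W (torusT W))

/-- **The cosets `T(k)/Z(k)`** (Mathlib's left-coset quotient; `Z(k)` is central, so left = right). -/
abbrev cosetQuot : Type := rationalOf W (torusT W) ⧸ centreInT W

/-- A representative of each coset (`Quotient.out`). -/
def cosetRep (c : cosetQuot W) : rationalOf W (torusT W) := Quotient.out c

/-- `Z(k)` is countable. -/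
theorem countable_rationalCentreT : Countable (rationalCentreT W) :=
  haveI : Countable (rationalOf W (torusT W)) := countable_rationalOf W _
  (Subgroup.inclusion_injective (rationalCentreT_le W)).countable

/-- `centreIncl` is the identity on the underlying torus element. -/
theorem centreIncl_coe (z : rationalCentreT W) : ((centreIncl W z : rationalOf W (torusT W)) : torusT W) = z :=
  Subgroup.coe_inclusion (rationalCentreT_le W) z

/-- **An element of `Z(k)` seen in `T′(k)`** (`Z ≤ T′`): the same element of `G(𝔸)`. -/
def centreInT' (z : rationalCentreT W) : rationalOf W (torusT' W) :=
  ⟨⟨((z : torusT W) : GA W), centre_le_torusT' W (rationalCentreT.mem_centre W z.2)⟩,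
    Subgroup.mem_subgroupOf.2 (rationalCentreT.mem_rationalPoints W z.2)⟩

/-- `centreInT'`, as an element of `T′`. -/
theorem centreInT'_val (z : rationalCentreT W) : (centreInT' W z : torusT' W) =
    ⟨((z : torusT W) : GA W), centre_le_torusT' W (rationalCentreT.mem_centre W z.2)⟩ := rfl

/-- `centreInT'` is the identity on the underlying adelic element. -/
theorem centreInT'_coe (z : rationalCentreT W) :
    (((centreInT' W z : rationalOf W (torusT' W)) : torusT' W) : GA W) = ((z : torusT W) : GA W) :=
  (congrArg Subtype.val (centreInT'_val W z)).trans (Subtype.coe_mk _ _)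

/-- **`(z, c) ↦ z · σ(c)` is a bijection `Z(k) × (T(k)/Z(k)) → T(k)`** (`Z(k)` central). -/
theorem bijective_centreIncl_mul_cosetRep :
    Function.Bijective (fun p : rationalCentreT W × cosetQuot W => centreIncl W p.1 * cosetRep W p.2) := by
  have hc : ∀ (z : rationalCentreT W) (g : rationalOf W (torusT W)),
      g * centreIncl W z = centreIncl W z * g := fun z g =>
    Subtype.ext (rationalCentreT.comm_torus W z.2 (g : torusT W))
  constructor
  · rintro ⟨z₁, c₁⟩ ⟨z₂, c₂⟩ h
    simp only at h
    have key : (cosetRep W c₂)⁻¹ * cosetRep W c₁ = centreIncl W (z₁⁻¹ * z₂) := by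
      have h1 : cosetRep W c₁ = centreIncl W z₁⁻¹ * (centreIncl W z₂ * cosetRep W c₂) := by
        rw [map_inv, ← h, inv_mul_cancel_left]
      rw [h1, ← hc z₂ (cosetRep W c₂), ← mul_assoc (centreIncl W z₁⁻¹), ← hc z₁⁻¹ (cosetRep W c₂), mul_assoc,
        inv_mul_cancel_left, map_mul]
    have hmem : (cosetRep W c₂)⁻¹ * cosetRep W c₁ ∈ centreInT W := by
      rw [key]
      exact Subgroup.mem_subgroupOf.2 (z₁⁻¹ * z₂).2
    have hc12 : c₂ = c₁ := by
      rw [← QuotientGroup.out_eq' c₂, ← QuotientGroup.out_eq' c₁]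
      exact QuotientGroup.eq.2 hmem
    subst hc12
    have hz : centreIncl W z₁ = centreIncl W z₂ := mul_right_cancel h
    rw [Subgroup.inclusion_injective (rationalCentreT_le W) hz]
  · intro g
    obtain ⟨h, hh⟩ := QuotientGroup.mk_out_eq_mul (centreInT W) g
    let zh : rationalCentreT W := ⟨((h : rationalOf W (torusT W)) : torusT W), Subgroup.mem_subgroupOf.1 h.2⟩
    have hzh : centreIncl W zh = (h : rationalOf W (torusT W)) := Subtype.ext rfl
    have hgh : g * (h : rationalOf W (torusT W)) = (h : rationalOf W (torusT W)) * g := by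
      rw [← hzh]
      exact hc zh g
    refine ⟨(zh⁻¹, QuotientGroup.mk g), ?_⟩
    show centreIncl W zh⁻¹ * cosetRep W (QuotientGroup.mk g) = g
    rw [cosetRep, hh, map_inv, hzh, hgh, inv_mul_cancel_left]

end Centre

/-! ### 3. The orbit of a regular `γ₀`, parametrised by `(T(k)/Z(k)) × T′(k)` -/

section Orbit

variable {k : Type} [Field k] [NumberField k] (W : PlaneData k)
  [MeasurableSpace (torusT W)] [MeasurableSpace (torusT' W)] (R : RTFData W)

omit [MeasurableSpace (torusT W)] [MeasurableSpace (torusT' W)] in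
/-- **Two pairs with the same orbit point differ by a diagonal central element** (`IsRegularRational`):
`δ₁⁻¹ γ₀ δ₁′ = δ₂⁻¹ γ₀ δ₂′` gives `u := δ₁ δ₂⁻¹ ∈ Z` and `δ₁′ δ₂′⁻¹ = u`. -/
theorem stabiliser_of_orbitMap_eq (γ₀ : rationalPoints W) (hreg : IsRegularRational W γ₀)
    {δ₁ δ₂ : rationalOf W (torusT W)} {δ₁' δ₂' : rationalOf W (torusT' W)}
    (h : orbitMap W γ₀ (δ₁, δ₁') = orbitMap W γ₀ (δ₂, δ₂')) :
    (((δ₁ : torusT W) * (δ₂ : torusT W)⁻¹ : torusT W) : GA W) ∈ centre W ∧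
      (((δ₁' : torusT' W) * (δ₂' : torusT' W)⁻¹ : torusT' W) : GA W) =
        (((δ₁ : torusT W) * (δ₂ : torusT W)⁻¹ : torusT W) : GA W) := by
  have hG : ((δ₁ : torusT W) : GA W)⁻¹ * (γ₀ : GA W) * ((δ₁' : torusT' W) : GA W) =
      ((δ₂ : torusT W) : GA W)⁻¹ * (γ₀ : GA W) * ((δ₂' : torusT' W) : GA W) := by
    have := congrArg (fun γ : rationalPoints W => (γ : GA W)) h
    simpa only [orbitMap_val] using this
  refine hreg _ ((δ₁ : torusT W) * (δ₂ : torusT W)⁻¹).2 _ ((δ₁' : torusT' W) * (δ₂' : torusT' W)⁻¹).2 ?_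
  rw [Subgroup.coe_mul, Subgroup.coe_mul, Subgroup.coe_inv, Subgroup.coe_inv, mul_inv_rev, inv_inv,
    mul_assoc ((δ₂ : torusT W) : GA W) (((δ₁ : torusT W) : GA W)⁻¹) (γ₀ : GA W),
    ← mul_assoc _ ((δ₁' : torusT' W) : GA W) (((δ₂' : torusT' W) : GA W)⁻¹),
    mul_assoc ((δ₂ : torusT W) : GA W) _ ((δ₁' : torusT' W) : GA W), hG,
    mul_assoc (((δ₂ : torusT W) : GA W)⁻¹) (γ₀ : GA W) ((δ₂' : torusT' W) : GA W), mul_inv_cancel_left,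
    mul_inv_cancel_right]

omit [MeasurableSpace (torusT W)] [MeasurableSpace (torusT' W)] in
/-- A diagonal central shift does not move the orbit point: `(δ z)⁻¹ γ₀ (z δ′) = δ⁻¹ γ₀ δ′`. -/
theorem orbitMap_mul_centre (γ₀ : rationalPoints W) (δ : rationalOf W (torusT W)) (δ' : rationalOf W (torusT' W))
    (z : rationalCentreT W) :
    orbitMap W γ₀ (δ * centreIncl W z, centreInT' W z * δ') = orbitMap W γ₀ (δ, δ') := by
  apply Subtype.ext
  rw [orbitMap_val, orbitMap_val]
  have hc : ∀ g : GA W, g * ((z : torusT W) : GA W) = ((z : torusT W) : GA W) * g := rationalCentreT.comm W z.2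
  have hcinv : ∀ g : GA W, g * ((z : torusT W) : GA W)⁻¹ = ((z : torusT W) : GA W)⁻¹ * g := fun g =>
    (Commute.inv_right (hc g : Commute g ((z : torusT W) : GA W))).eq
  simp only [Subgroup.coe_mul, centreIncl_coe, centreInT'_coe]
  rw [mul_inv_rev, ← hcinv (((δ : torusT W) : GA W)⁻¹), mul_assoc (((δ : torusT W) : GA W)⁻¹),
    ← hcinv (γ₀ : GA W), ← mul_assoc (((δ : torusT W) : GA W)⁻¹), mul_assoc (((δ : torusT W) : GA W)⁻¹ * γ₀),
    inv_mul_cancel_left]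

/-- **The orbit map on coset representatives**: `(c, δ′) ↦ σ(c)⁻¹ γ₀ δ′`. -/
def orbitMapRep (γ₀ : rationalPoints W) (p : cosetQuot W × rationalOf W (torusT' W)) : rationalPoints W :=
  orbitMap W γ₀ (cosetRep W p.1, p.2)

omit [MeasurableSpace (torusT W)] [MeasurableSpace (torusT' W)] in
/-- **The orbit map on coset representatives is injective** for a regular `γ₀` (the diagonal centre is the whole
stabiliser, and the representatives are in distinct `Z(k)`-cosets). -/
theorem orbitMapRep_injective (γ₀ : rationalPoints W) (hreg : IsRegularRational W γ₀) :
    Function.Injective (orbitMapRep W γ₀) := by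
  rintro ⟨c₁, δ₁'⟩ ⟨c₂, δ₂'⟩ h
  obtain ⟨hz, hte⟩ := stabiliser_of_orbitMap_eq W γ₀ hreg h
  set u : torusT W := (cosetRep W c₁ : torusT W) * (cosetRep W c₂ : torusT W)⁻¹ with hu
  have hur : u ∈ rationalOf W (torusT W) := by
    have := (cosetRep W c₁ * (cosetRep W c₂)⁻¹).2
    rwa [Subgroup.coe_mul, Subgroup.coe_inv] at this
  have huZ : u ∈ rationalCentreT W := Subgroup.mem_inf.2 ⟨hur, Subgroup.mem_subgroupOf.2 hz⟩
  have hmem : (cosetRep W c₂)⁻¹ * cosetRep W c₁ ∈ centreInT W := by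
    refine Subgroup.mem_subgroupOf.2 ?_
    have hcu : (cosetRep W c₂ : torusT W) * u = u * (cosetRep W c₂ : torusT W) :=
      rationalCentreT.comm_torus W huZ (cosetRep W c₂ : torusT W)
    have h1 : (cosetRep W c₁ : torusT W) = u * (cosetRep W c₂ : torusT W) := mul_inv_eq_iff_eq_mul.1 hu.symm
    have : (((cosetRep W c₂)⁻¹ * cosetRep W c₁ : rationalOf W (torusT W)) : torusT W) = u := by
      rw [Subgroup.coe_mul, Subgroup.coe_inv, h1, ← hcu, inv_mul_cancel_left]
    rw [this]
    exact huZ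
  have hc12 : c₂ = c₁ := by
    rw [← QuotientGroup.out_eq' c₂, ← QuotientGroup.out_eq' c₁]
    exact QuotientGroup.eq.2 hmem
  subst hc12
  have hu1 : u = 1 := by rw [hu, mul_inv_cancel]
  have h2 : (δ₁' : torusT' W) * (δ₂' : torusT' W)⁻¹ = 1 := by
    apply Subtype.ext
    rw [hte, hu1, OneMemClass.coe_one, OneMemClass.coe_one]
  have h3 : (δ₁' : torusT' W) = (δ₂' : torusT' W) := mul_inv_eq_one.1 h2
  rw [Subtype.ext h3]

omit [MeasurableSpace (torusT W)] [MeasurableSpace (torusT' W)] in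
/-- **The orbit map on coset representatives has the same range as the orbit map** (`T(k) = Z(k) · σ(T(k)/Z(k))`). -/
theorem range_orbitMapRep (γ₀ : rationalPoints W) :
    Set.range (orbitMapRep W γ₀) = Set.range (orbitMap W γ₀) := by
  ext γ
  constructor
  · rintro ⟨⟨c, δ'⟩, rfl⟩
    exact ⟨(cosetRep W c, δ'), rfl⟩
  · rintro ⟨⟨δ, δ'⟩, rfl⟩
    obtain ⟨h, hh⟩ := QuotientGroup.mk_out_eq_mul (centreInT W) δ
    let z : rationalCentreT W := ⟨((h : rationalOf W (torusT W)) : torusT W), Subgroup.mem_subgroupOf.1 h.2⟩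
    have hz : centreIncl W z = (h : rationalOf W (torusT W)) := Subtype.ext rfl
    refine ⟨(QuotientGroup.mk δ, centreInT' W z * δ'), ?_⟩
    show orbitMap W γ₀ (cosetRep W (QuotientGroup.mk δ), centreInT' W z * δ') = orbitMap W γ₀ (δ, δ')
    rw [cosetRep, hh, ← hz, orbitMap_mul_centre]

/-- **(a) The orbit sum is the double sum over `(T(k)/Z(k)) × T′(k)`.** -/
theorem tsum_orbit_eq_tsum_tsum_rep (f : GA W → ℂ) (γ₀ : rationalPoints W) (hreg : IsRegularRational W γ₀)
    (hs : Summable (fun γ : Set.range (orbitMap W γ₀) => R.orbitalc ((γ : rationalPoints W) : GA W) f)) :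
    (∑' γ : Set.range (orbitMap W γ₀), R.orbitalc ((γ : rationalPoints W) : GA W) f) =
      ∑' c : cosetQuot W, ∑' δ' : rationalOf W (torusT' W),
        R.orbitalc (((cosetRep W c : torusT W) : GA W)⁻¹ * (γ₀ : GA W) * ((δ' : torusT' W) : GA W)) f := by
  have hinj := orbitMapRep_injective W γ₀ hreg
  rw [← tsum_congr_set_coe (fun γ : rationalPoints W => R.orbitalc (γ : GA W) f) (range_orbitMapRep W γ₀),
    tsum_range (fun γ : rationalPoints W => R.orbitalc (γ : GA W) f) hinj]
  have hs' : Summable (fun p : cosetQuot W × rationalOf W (torusT' W) =>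
      R.orbitalc ((orbitMapRep W γ₀ p : rationalPoints W) : GA W) f) := by
    rw [← range_orbitMapRep W γ₀] at hs
    have := (Equiv.ofInjective _ hinj).summable_iff.2 hs
    simpa only [Function.comp_def, Equiv.ofInjective_apply] using this
  rw [hs'.tsum_prod]
  unfold orbitMapRep
  simp only [orbitMap_val]

end Orbit

end Summit.Ventures.HodgeRepro.Tier4.Line4

end
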